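import Mathlib.LinearAlgebra.Quotient.Basic
import Mathlib.LinearAlgebra.Isomorphisms
import Mathlib.SetTheory.Cardinal.Finite
import Mathlib.GroupTheory.Index
import HarnessLib

/-!
# Kernels and cokernels of COMPOSITES of linear maps: finiteness and cardinality bounds
# `#ker(g ∘ f) ≤ #ker f · #ker g`, `#coker(g ∘ f) ≤ #coker g · #coker f` (module algebra; proofs file)

Topic `NumberTheory/EllipticCurves` (next to `IwasawaAlgebraSpecializationIndexComparisonProofs`, whose
`…_of_finite_ker_coker` lemmas take ONE map with finite kernel and cokernel). THEOREMS ONLY (no definition, no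
named fact, no instance, no `sorry`); any commutative ring.

WHAT. For linear maps `f : A → B`, `g : B → C`:
* `finite_ker_comp`, `natCard_ker_comp_le` — if `ker f` and `ker g` are finite then `ker (g ∘ f)` is finite and
  `#ker(g ∘ f) ≤ #ker f · #ker g` (`f` maps `ker(g ∘ f)` to `ker g` with kernel `ker f`);
* `finite_coker_comp`, `natCard_coker_comp_le` — if `B/range f` and `C/range g` are finite then `C/range(g ∘ f)`
  is finite and `#(C/range(g ∘ f)) ≤ #(C/range g) · #(B/range f)` (`range g / range(g ∘ f)` is a quotient of
  `B/range f`).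

WHY (use). CONTROL MAPS COMPOSE: in the control theorem at Howard's Eisenstein primes `𝔮 = q_m` [Howard 2004,
Lemma 2.2.7 / Prop. 2.2.8, proof of Thm. 2.2.10] the comparison `𝔖/𝔮𝔖 → H¹_ℱ(K, T_𝔮)` (and its dual) is a
composite of several maps (change of coefficients, inflation/Shapiro, global-to-Selmer), each with kernel and
cokernel finite of cardinality bounded independently of `m` (the tree's `IwasawaAlgebraSpecializationTorsion*`
lemmas bound the individual error groups); these two lemmas turn the list of bounds into the single constants
`#coker f ≤ c`, `#ker h ≤ c` of the witness interface `SpecWitness` (cell `pub/bsd-print-x9`, shared μ-item of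
rows 9/10). Nothing about Galois cohomology is asserted here.

References: [Howard2004HeegnerKolyvagin] Lemma 2.2.7, Prop. 2.2.8; [Washington1997] §13.3 (index bookkeeping in
the proof of Thm. 13.13).
-/

noncomputable section

open Function

universe u v w x

namespace Literature.NumberTheory.EllipticCurves

namespace LinearMap

variable {R : Type u} [CommRing R] {A : Type v} {B : Type w} {C : Type x}
  [AddCommGroup A] [Module R A] [AddCommGroup B] [Module R B] [AddCommGroup C] [Module R C]
  (f : A →ₗ[R] B) (g : B →ₗ[R] C)

/-! ## Kernels of composites -/

/-- **`#ker(g ∘ f) ≤ #ker f · #ker g`, with finiteness**: `f` restricts to a linear map `ker(g ∘ f) → ker g`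
whose kernel is (a copy of) `ker f`; so if `ker f` and `ker g` are finite, `ker(g ∘ f)` is finite of cardinality
at most the product. [cite: Washington1997, §13.3 (proof of Thm. 13.13, index bookkeeping)]
[cite: Howard2004HeegnerKolyvagin, Prop. 2.2.8] -/
theorem finite_ker_comp_and_natCard_le [Finite (LinearMap.ker f)] [Finite (LinearMap.ker g)] :
    Finite (LinearMap.ker (g ∘ₗ f)) ∧
      Nat.card (LinearMap.ker (g ∘ₗ f)) ≤ Nat.card (LinearMap.ker f) * Nat.card (LinearMap.ker g) := by
  -- `f` restricted to `ker (g ∘ f)` lands in `ker g`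
  have hmap : ∀ x ∈ LinearMap.ker (g ∘ₗ f), f x ∈ LinearMap.ker g := by
    intro x hx
    rw [LinearMap.mem_ker] at hx ⊢
    exact hx
  set φ : LinearMap.ker (g ∘ₗ f) →ₗ[R] LinearMap.ker g := f.restrict hmap with hφ
  -- its kernel embeds into `ker f`
  let ι : LinearMap.ker φ → LinearMap.ker f := fun x =>
    ⟨((x : LinearMap.ker (g ∘ₗ f)) : A), by
      have hx : φ x = 0 := x.2
      have : f ((x : LinearMap.ker (g ∘ₗ f)) : A) = 0 := congrArg Subtype.val hx
      exact this⟩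
  have hι : Function.Injective ι := by
    intro a b hab
    have := congrArg (fun z : LinearMap.ker f => (z : A)) hab
    exact Subtype.ext (Subtype.ext this)
  haveI : Finite (LinearMap.ker φ) := Finite.of_injective ι hι
  have hk : Nat.card (LinearMap.ker φ) ≤ Nat.card (LinearMap.ker f) := Nat.card_le_card_of_injective ι hι
  -- its image sits inside `ker g`
  haveI : Finite (LinearMap.range φ) := Finite.of_injective _ (LinearMap.range φ).injective_subtype
  have hr : Nat.card (LinearMap.ker (g ∘ₗ f) ⧸ LinearMap.ker φ) ≤ Nat.card (LinearMap.ker g) := by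
    rw [Nat.card_congr φ.quotKerEquivRange.toEquiv]
    exact Nat.card_le_card_of_injective _ (LinearMap.range φ).injective_subtype
  haveI : Finite (LinearMap.ker (g ∘ₗ f) ⧸ LinearMap.ker φ) :=
    Finite.of_equiv _ φ.quotKerEquivRange.toEquiv.symm
  have hcard := Submodule.card_eq_card_quotient_mul_card (LinearMap.ker φ) (M := LinearMap.ker (g ∘ₗ f))
  have hfin : Finite (LinearMap.ker (g ∘ₗ f)) := by
    apply Nat.finite_of_card_ne_zero
    rw [hcard]
    exact Nat.mul_ne_zero Nat.card_pos.ne' Nat.card_pos.ne'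
  refine ⟨hfin, ?_⟩
  rw [hcard]
  calc Nat.card (LinearMap.ker φ) * Nat.card (LinearMap.ker (g ∘ₗ f) ⧸ LinearMap.ker φ)
      ≤ Nat.card (LinearMap.ker f) * Nat.card (LinearMap.ker g) := Nat.mul_le_mul hk hr

/-- `ker(g ∘ f)` is finite when `ker f` and `ker g` are. [cite: Washington1997, §13.3] -/
theorem finite_ker_comp [Finite (LinearMap.ker f)] [Finite (LinearMap.ker g)] :
    Finite (LinearMap.ker (g ∘ₗ f)) :=
  (finite_ker_comp_and_natCard_le f g).1

/-- `#ker(g ∘ f) ≤ #ker f · #ker g`. [cite: Washington1997, §13.3] [cite: Howard2004HeegnerKolyvagin, Prop. 2.2.8] -/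
theorem natCard_ker_comp_le [Finite (LinearMap.ker f)] [Finite (LinearMap.ker g)] :
    Nat.card (LinearMap.ker (g ∘ₗ f)) ≤ Nat.card (LinearMap.ker f) * Nat.card (LinearMap.ker g) :=
  (finite_ker_comp_and_natCard_le f g).2

/-! ## Cokernels of composites -/

/-- **`#(C/range(g ∘ f)) ≤ #(C/range g) · #(B/range f)`, with finiteness**: `range(g ∘ f) ≤ range g`, and
`range g / range(g ∘ f)` — i.e. the image of `range g` in `C/range(g ∘ f)` — is the image of `B` under
`mkQ ∘ g`, which kills `range f`, hence a quotient of `B/range f`; and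
`#(C/range(g∘f)) = #(range g / range(g∘f)) · #(C/range g)`.
[cite: Washington1997, §13.3 (proof of Thm. 13.13, index bookkeeping)] [cite: Howard2004HeegnerKolyvagin, Prop. 2.2.8] -/
theorem finite_coker_comp_and_natCard_le [Finite (B ⧸ LinearMap.range f)] [Finite (C ⧸ LinearMap.range g)] :
    Finite (C ⧸ LinearMap.range (g ∘ₗ f)) ∧
      Nat.card (C ⧸ LinearMap.range (g ∘ₗ f)) ≤
        Nat.card (C ⧸ LinearMap.range g) * Nat.card (B ⧸ LinearMap.range f) := by
  have hle : LinearMap.range (g ∘ₗ f) ≤ LinearMap.range g := by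
    rintro _ ⟨a, rfl⟩
    exact ⟨f a, rfl⟩
  -- `#(C/range(g∘f)) = #((range g).map mkQ) * #(C/range g)`
  have hmul := Submodule.card_quotient_mul_card_quotient (LinearMap.range g) (LinearMap.range (g ∘ₗ f)) hle
  -- `(range g).map mkQ = range (mkQ ∘ g)` is a quotient of `B / range f`
  have hmap : (LinearMap.range g).map (LinearMap.range (g ∘ₗ f)).mkQ =
      LinearMap.range ((LinearMap.range (g ∘ₗ f)).mkQ ∘ₗ g) := by
    rw [LinearMap.range_comp _ (LinearMap.range (g ∘ₗ f)).mkQ]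
  have hker : LinearMap.range f ≤ LinearMap.ker ((LinearMap.range (g ∘ₗ f)).mkQ ∘ₗ g) := by
    rintro _ ⟨a, rfl⟩
    rw [LinearMap.mem_ker, LinearMap.comp_apply, Submodule.mkQ_apply, Submodule.Quotient.mk_eq_zero]
    exact ⟨a, rfl⟩
  let ψ : (B ⧸ LinearMap.range f) →ₗ[R] (C ⧸ LinearMap.range (g ∘ₗ f)) :=
    (LinearMap.range f).liftQ ((LinearMap.range (g ∘ₗ f)).mkQ ∘ₗ g) hker
  have hψ : LinearMap.range ψ = (LinearMap.range g).map (LinearMap.range (g ∘ₗ f)).mkQ := by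
    rw [hmap]
    exact Submodule.range_liftQ _ _ _
  have hsurj : Nat.card ((LinearMap.range g).map (LinearMap.range (g ∘ₗ f)).mkQ) ≤
      Nat.card (B ⧸ LinearMap.range f) := by
    rw [← hψ]
    exact Nat.card_le_card_of_surjective _ ψ.surjective_rangeRestrict
  haveI : Finite ((LinearMap.range g).map (LinearMap.range (g ∘ₗ f)).mkQ) := by
    rw [← hψ]
    exact Finite.of_surjective _ ψ.surjective_rangeRestrict
  have hfin : Finite (C ⧸ LinearMap.range (g ∘ₗ f)) := by
    apply Nat.finite_of_card_ne_zero
    rw [← hmul]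
    exact Nat.mul_ne_zero Nat.card_pos.ne' Nat.card_pos.ne'
  refine ⟨hfin, ?_⟩
  rw [← hmul, mul_comm]
  exact Nat.mul_le_mul le_rfl hsurj

/-- `C/range(g ∘ f)` is finite when `B/range f` and `C/range g` are. [cite: Washington1997, §13.3] -/
theorem finite_coker_comp [Finite (B ⧸ LinearMap.range f)] [Finite (C ⧸ LinearMap.range g)] :
    Finite (C ⧸ LinearMap.range (g ∘ₗ f)) :=
  (finite_coker_comp_and_natCard_le f g).1

/-- `#(C/range(g ∘ f)) ≤ #(C/range g) · #(B/range f)`. [cite: Washington1997, §13.3]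
[cite: Howard2004HeegnerKolyvagin, Prop. 2.2.8] -/
theorem natCard_coker_comp_le [Finite (B ⧸ LinearMap.range f)] [Finite (C ⧸ LinearMap.range g)] :
    Nat.card (C ⧸ LinearMap.range (g ∘ₗ f)) ≤
      Nat.card (C ⧸ LinearMap.range g) * Nat.card (B ⧸ LinearMap.range f) :=
  (finite_coker_comp_and_natCard_le f g).2

end LinearMap

end Literature.NumberTheory.EllipticCurves

end
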